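import Mathlib.Data.Nat.Prime.Basic
import Mathlib.Data.Int.GCD
import Mathlib.Tactic
import HarnessLib

/-!
# [CP-II] ch.4 III (`κ(x) = 6`) read inside [CP3] ch.8 — kernel-checked arithmetic of the node map

Companion to `Kappa2Assembly2019` (same directory).  Source texts:

* [CP-II] = Cossart–Piltant, *Resolution of singularities of threefolds in positive
  characteristic II*, J. Algebra 321 (2009), HAL hal-00139445v2, ch.4 III.5 Case 2
  (ms 139–140): "This yields `a(1)+ω(x)−1 ≡ 0 mod p`, `b(2)(b(2)+1) ≢ 0 mod p`, and
  `2(b̄(2)+1) = p` … The latter condition implies `p = 2`, incompatible with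
  `b(2)(b(2)+1) ≢ 0 mod p`."
* [CP3] = Cossart–Piltant, *Resolution of singularities of arithmetical threefolds*,
  J. Algebra 529 (2019), arXiv:1412.0868v1, Lemma 7.3 (joyeux) (ii): "`a₃+ω−a ≡ 0 mod p`,
  `a₁a₂ ≠ 0` and `a₁+a₂+a = p`. In particular `p ≥ 3`."; Prop. 8.5, end of proof:
  "`d′₁+(ω(x)−1)/p ∈ ℕ` … Turning back to (8034) [`(d′₁,d′₂,d′₃) = (d₁,d₂,d₁+d₂−1+ω(x)/p)`],
  we get `\widehat{pd′₃} = \widehat{pd′₂}+1`, `2(\widehat{pd′₂}+1) = p`.  This is a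
  contradiction, since `p ≥ 3`."

CERT-K in the sense of the cell's MODULE-MAP: the theorems below check the DISPLAYED
arithmetic of the two closing arguments and of the exponent bookkeeping that the node map
(pub-hironaka ARITH.md §13.6) identifies across the two papers.  Nothing here asserts the
truth of any statement of [CP-II] or [CP3]; no `Summits` import, no named fact, no `sorry`.
-/

namespace Literature.AlgebraicGeometry.CossartPiltant200819.KappaSixReading2009

/-! ## The common parity step -/

/-- A prime of the form `2(m+1)` is `2` (and then `m = 0`).
[cite: CossartPiltant2009, ch.4 III.5 Case 2 (ms 140)] -/
theorem prime_eq_two_mul_succ {p m : ℕ} (hp : p.Prime) (h : 2 * (m + 1) = p) :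
    p = 2 ∧ m = 0 := by
  have h2 : 2 ∣ p := ⟨m + 1, by omega⟩
  have hp2 : p = 2 := by
    rcases (Nat.Prime.eq_one_or_self_of_dvd hp 2 h2) with h | h
    · omega
    · omega
  refine ⟨hp2, by omega⟩

/-- [CP3] Lem. 7.3 (joyeux) (ii), last clause: residues `a₁, a₂ ≠ 0` with `a₁ + a₂ + a = p`
and `a = î ≥ 1` force `p ≥ 3`. [cite: CossartPiltant2019, Lem. 7.3 (ii)] -/
theorem joyeux_ii_three_le {p a a₁ a₂ : ℕ} (h₁ : a₁ ≠ 0) (h₂ : a₂ ≠ 0) (ha : 1 ≤ a)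
    (hsum : a₁ + a₂ + a = p) : 3 ≤ p := by
  omega

/-- [CP3] Prop. 8.5, closing line: `2(\widehat{pd′₂}+1) = p` contradicts `p ≥ 3` (for `p`
prime).  Here `m` stands for the residue `\widehat{pd′₂}`.
[cite: CossartPiltant2019, Prop. 8.5 (end of proof)] -/
theorem cp3_prop85_closing {p m : ℕ} (hp : p.Prime) (h3 : 3 ≤ p) (h : 2 * (m + 1) = p) :
    False := by
  have := (prime_eq_two_mul_succ hp h).1
  omega

/-- `b(b+1)` is always even (the fact behind [CP-II]'s "incompatible").
[cite: CossartPiltant2009, ch.4 III.5 Case 2 (ms 140)] -/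
theorem two_dvd_mul_succ (b : ℤ) : 2 ∣ b * (b + 1) := by
  rcases Int.even_or_odd b with ⟨k, hk⟩ | ⟨k, hk⟩
  · exact ⟨k * (b + 1), by rw [hk]; ring⟩
  · exact ⟨b * (k + 1), by rw [hk]; ring⟩

/-- [CP-II] ch.4 III.5 Case 2, closing lines: with `b̄` the residue of the integer `b(2)`
modulo `p`, the conditions `b(2)(b(2)+1) ≢ 0 mod p` and `2(b̄+1) = p` are incompatible
(`p` prime): the latter forces `p = 2`, and `b(b+1)` is even.
[cite: CossartPiltant2009, ch.4 III.5 Case 2 (ms 140)] -/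
theorem cp2_III5_case2_closing {p : ℕ} (hp : p.Prime) (b : ℤ)
    (hb : ¬ ((p : ℤ) ∣ b * (b + 1))) (h : 2 * ((b % (p : ℤ)).toNat + 1) = p) : False := by
  have hp2 : p = 2 := (prime_eq_two_mul_succ hp h).1
  subst hp2
  exact hb (by exact_mod_cast two_dvd_mul_succ b)

/-- The two closings are the same dichotomy: under `2(m+1) = p`, `p` prime, EITHER route
(`p ≥ 3` from joyeux (ii), or "`b(b+1)` even" from [CP-II]) ends in `False`; recorded as the
statement that the hypothesis pins `(p, m) = (2, 0)`.
[cite: CossartPiltant2009, ch.4 III.5 Case 2; CossartPiltant2019, Prop. 8.5] -/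
theorem closings_agree {p m : ℕ} (hp : p.Prime) (h : 2 * (m + 1) = p) :
    (p = 2 ∧ m = 0) ∧ (3 ≤ p → False) ∧ (∀ b : ℤ, (p : ℤ) ∣ b * (b + 1)) := by
  obtain ⟨hp2, hm⟩ := prime_eq_two_mul_succ hp h
  refine ⟨⟨hp2, hm⟩, fun h3 => by omega, fun b => ?_⟩
  subst hp2
  exact_mod_cast two_dvd_mul_succ b

/-! ## Exponent bookkeeping at the second blow-up (`x″` of [CP-II] = `x₁` of [CP3] Prop. 8.5) -/

/-- [CP3] (8034) with `d′₁ + (ω−1)/p ∈ ℕ`: writing `e_j := p d′_j` (integers) and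
`e₃ = e₁ + e₂ − p + ω`, the congruence `e₁ + ω − 1 ≡ 0 [mod p]` gives `e₃ ≡ e₂ + 1 [mod p]`
("we get `\widehat{pd′₃} = \widehat{pd′₂} + 1`").  [CP-II] III.5 Case 2 has the identical step
with `(e₁, e₂, e₃) = (a(1), b(2), a(1)+b(2)+ω−p)` and "`a(1)+ω(x)−1 ≡ 0 mod p`".
[cite: CossartPiltant2019, Prop. 8.5 (8034); CossartPiltant2009, ch.4 III.5 (3)] -/
theorem third_exponent_congr (p e₁ e₂ ω : ℤ) (h : (p : ℤ) ∣ e₁ + ω - 1) :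
    Int.ModEq p (e₁ + e₂ - p + ω) (e₂ + 1) := by
  obtain ⟨k, hk⟩ := h
  refine (Int.modEq_iff_dvd.mpr ⟨-(k - 1), ?_⟩)
  linear_combination (-1 : ℤ) * hk

/-- The [CP-II] exponent triple of `H(x″)` (ms 139, display (3)) and the [CP3] triple
`p·(d′₁,d′₂,d′₃)` of (8034) are the same expression under the dictionary `a(1) ↦ pd₁`,
`b(2) ↦ pd₂` (ARITH §8 / §13.6): a definitional identity, recorded for the map.
[cite: CossartPiltant2009, ch.4 III.5 (3); CossartPiltant2019, Prop. 8.5 (8034)] -/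
theorem exponent_triples_match (a1 b2 ω p : ℤ) :
    (a1, b2, a1 + b2 + ω - p) = (a1, b2, a1 + b2 - p + ω) := by
  simp only [Prod.mk.injEq]
  refine ⟨trivial, trivial, by ring⟩

/-! ## The order count at `x″` -/

/-- [CP-II] III.5 Case 2: "`deg_{U₃}Ψ ≥ 2`, so `ord u″₃Ψ(u″₁,1,1) = 1 + ω − deg_{U₃}Ψ ≤ ω − 1`";
[CP3] Prop. 8.5 (ii)/(8033): "`v₃ > 1/p`", "`x₁` is very near `x` only if `v₃ = 2/p`", with
`v₃ = deg_{U₃}Φ/p` (Prop. 8.6, (803) sqq.).  The two inequalities are the same integer fact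
(stated over `ℤ` to avoid truncated subtraction).
[cite: CossartPiltant2009, ch.4 III.5 Case 2; CossartPiltant2019, Prop. 8.5 (ii)] -/
theorem order_count_iff (ω d : ℤ) : 1 + ω - d ≤ ω - 1 ↔ 2 ≤ d := by
  constructor <;> intro h <;> linarith

/-- `v₃ = d/p > 1/p ↔ d ≥ 2` for a positive integer `p` (the rational form used by [CP3]).
[cite: CossartPiltant2019, Prop. 8.5 (ii)] -/
theorem v3_gt_iff (p d : ℕ) (hp : 0 < p) :
    (1 : ℚ) / p < (d : ℚ) / p ↔ 2 ≤ d := by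
  have hp' : (0 : ℚ) < p := by exact_mod_cast hp
  rw [div_lt_div_iff_of_pos_right hp', Nat.one_lt_cast]
  omega

end Literature.AlgebraicGeometry.CossartPiltant200819.KappaSixReading2009
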